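import Mathlib
import HarnessLib
import HarnessLib.Audit
import Summits.MatrixMultiplication.Statement
import Literature.Computability.AlgebraicComplexity.MatrixMultiplicationExponent
import Literature.Computability.AlgebraicComplexity.AsymptoticSpectrum
import Literature.Computability.AlgebraicComplexity.FlatteningBound
import HarnessLib.Audit.Status.Attr

/-!
Route: AssociativePencil

DORMANT since 2026-08-22T04:18:03Z (reconciler: no traction for 5.1 d (last activity item-evidence-added at 2026-08-17T02:19:31Z); parked, not closed — `ledger route dormant route-MatrixMultiplication-AssociativePencil --off` to reactiv) — unstaffed, not closed; items shared with open routes are served there. `ledger route dormant <id> --off` reactivates.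

# Route AssociativePencil — Mat_n as a Lagrange interpolant of tame associative products
(Odesskii–Sokolov pencils)

X = TAME-NODE CURVES (card associative-pencil-lagrange-interpolation, sharpened): for every ε > 0
there is C such that for
infinitely many n there is a polynomial family F(t) = Σ_(j≤s) t^j ν_j of ASSOCIATIVE multiplications
on ℂ^(n×n) (every fibre
associative) whose top coefficient ν_s is the matrix product μ_n = ⟨n,n,n⟩ (Mat_n is the fibre at t
= ∞), with at most n^ε
NODES: s+1 distinct parameters t_i whose fibres are TAME, i.e. of tensor rank ≤ C·n² (linear in
their dimension n²). By the
divided-difference form of Lagrange interpolation μ_n = Σ_i F(t_i)/Π_(k≠i)(t_i − t_k), so R(⟨n,n,n⟩)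
≤ (s+1)·C·n² ≤ C·n^(2+ε)
for infinitely many n, hence ω(ℂ) = 2. For s = 1 the families are exactly the associative products
COMPATIBLE with Mat_n
(μ_n = B₁ + B₂ with B₁, B₂ associative ⟺ μ_n + tB₁ associative for all t), classified by
Odesskii–Sokolov M-structures /
Nijenhuis operators; block recursion ⟨n,n,n⟩ = X·P·Y + X·(1−P)·Y is the sandwich pencil. The card's
rate "nodes of rank
n^(2+o(1))" is deliberately NOT used: that form is implied by ω = 2 through the sandwich pencil;
tameness (rank O(n²) per node,
the o(1) only in the number of nodes) is what "cheap because degenerate" means and is not implied by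
ω = 2.
Lean: `∀ ε : ℝ, 0 < ε → ∃ C : ℝ, 0 < C ∧ ∀ n₀ : ℕ, ∃ n : ℕ, n₀ ≤ n ∧ 2 ≤ n ∧ ∃ s : ℕ, (s : ℝ) + 1 ≤
(n : ℝ) ^ ε ∧ ∃ ν : Fin (s + 1) → (Fin n × Fin n → Fin n × Fin n → Fin n × Fin n → ℂ), ν (Fin.last
s) = Literature.Computability.AlgebraicComplexity.matMulTensor ℂ n n n ∧ (∀ t : ℂ, ∀ x y z w : Fin n
× Fin n, ∑ u, (∑ j : Fin (s + 1), t ^ (j : ℕ) * ν j u x y) * (∑ j : Fin (s + 1), t ^ (j : ℕ) * ν j w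
u z) = ∑ v, (∑ j : Fin (s + 1), t ^ (j : ℕ) * ν j v y z) * (∑ j : Fin (s + 1), t ^ (j : ℕ) * ν j w x
v)) ∧ ∃ node : Fin (s + 1) → ℂ, Function.Injective node ∧ ∀ i,
(Literature.Computability.AlgebraicComplexity.tensorRank (fun z x y => ∑ j : Fin (s + 1), node i ^
(j : ℕ) * ν j z x y) : ℝ) ≤ C * (n : ℝ) ^ 2`

## Assembly
Pure bookkeeping given the two support items: fix ε > 0, take C and the infinitely many n from
TameNodeCurves; at each such n
LagrangeNodeBound gives R(⟨n,n,n⟩) = R(ν_s) ≤ Σ_i R(F(t_i)) ≤ (s+1)·C·n² ≤ C·n^(2+ε) (as s+1 ≤ n^ε);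
RankBoundToOmega gives
ω(ℂ) ≤ 2 + ε; ε → 0 gives ω(ℂ) ≤ 2, and 2 ≤ ω(ℂ) is
Theorems/AsymptoticSpectrumOmegaGeTwo.two_le_omega (PROVED), so ω(ℂ) = 2
= MatrixMultiplication (MatrixMultiplication_iff). All glue is in the proved cone
(tensorRank_add_le, Blaser2013Thm59_holds,
two_le_omega); no unproved named fact is imported.

Rationale: WHY THIS LINE. Mechanism (card associative-pencil-lagrange-interpolation): Mat_n is a point of the
variety Alg_N (N = n²) of associative
multiplications with OPEN orbit (Gerstenhaber rigidity, HH²(Mat_n) = 0), so a rational curve of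
associative products through
it is generically ≅ Mat_n and its degenerate fibres are algebra-degenerations of Mat_n; Lagrange
interpolation at the nodes is
an exact LINEAR self-reduction of ⟨n,n,n⟩ into other associative algebras on the same space (Bini's
interpolation device,
BurgisserClausenShokrollahi1997 Prop. (15.26), pointed at Alg_N instead of at ε-algorithms). The
supply of lines is
classified mathematics from integrable systems, never costed in complexity theory: compatible
associative products on Mat_n
are x∘y = R(x)y + xR(y) − R(xy) for operators R(x) = Σ a_i x b^i + cx attached to M-structures
(OdesskiiSokolov2006 = arXiv
math/0512499; OdesskiiSokolov2007 = arXiv math/0611200 §3–4: semisimple M-structures ↔ affine Dynkin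
quivers Ã_(2k−1),
D̃_k, Ẽ_6,7,8, in all of which S_λ = 1 + λR, i.e. R is a Nijenhuis operator,
CarinenaGrabowskiMarmo2000; Mat_2 completely:
Sokolov2017 Prop. 3.1 — sandwiches X·c·Y and (aX−Xa)(bY−Yb)). Read this way the NODES of a pencil
are the eigenvalues ρ of
R and the node algebra B_ρ surjects onto the subalgebra im(R − ρ) ⊂ Mat_n with kernel the
ρ-eigenspace — the handle for
both sides: cheap nodes need cheap subalgebras of Mat_n of total dimension ≥ n² (cruxes
NodeQuotients,
LargeSubalgebraMatMul, NodeRigidity), and a non-sandwich pencil beating a record is a finite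
decidable question
(StrassenPencil). Imported: deformation theory of associative algebras / Nijenhuis operators /
quiver representations
(integrable-systems literature) and structure theory of large subalgebras of Mat_n (Agore2016). No
prior route uses Alg_N,
compatible products or exact linear identities between ⟨n,n,n⟩ and other algebras (nearest:
NilCoxeterShadow uses ONE
degeneration of ℂ[S_n] on the negative side; RectangularAlpha's assembly is the same one-format
bookkeeping).

RANKED CRUXES. #0 TameNodeCurves (target) — X as in § Thesis: ∀ε>0 ∃C ∀n₀ ∃n≥n₀ ∃s with s+1 ≤ n^ε
and a degree-s polynomial family of associative products on ℂ^(n×n) with top coefficient ⟨n,n,n⟩ and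
s+1 distinct nodes of tensor rank ≤ C·n². (why it might fail: NodeRigidity: for s = 1 one node
always carries ⟨a,b,c⟩ with abc ≥ ηn³, so tame pencils force R(⟨m,m,m⟩) = O(m²); tame higher-degree
curves may not exist either (every node is a degeneration of Mat_n and cheap ones may span too
little).) [OdesskiiSokolov2007, OdesskiiSokolov2006, BurgisserClausenShokrollahi1997,
BlaserLysikov2016, LimYe2020]
#2 NodeRigidity (crux) — NEGATIVE ENGINE (parent of NodeQuotients + LargeSubalgebraMatMul; card
"fastest refutation" made precise): there is an absolute η > 0 such that for every n and every
associative ν on ℂ^(n×n) with μ_n − ν associative (i.e. every pair of nodes of every associative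
pencil through Mat_n, up to scaling), one of the two node tensors ν, μ_n − ν restricts to a matrix
product ⟨a,b,c⟩ with abc ≥ η·n³. Consequence: pencil nodes are never cheaper than linear-size MaMu,
pencils are self-reductions only, and TameNodeCurves at s = 1 becomes R(⟨m,m,m⟩) = O(m²) infinitely
often. Its REFUTATION is exactly the exotic pencil the positive side wants — informative both ways.
[difficulty: L] (why it might fail: compatible products outside the Nijenhuis normal form (S_λ with
higher Taylor terms; M-structures with non-semisimple A, B are unclassified) may have two nodes
whose Mat_n-quotients are both small; and RESTRICTION to a full ⟨a,b,c⟩ is demanded, not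
degeneration.) [OdesskiiSokolov2007, Sokolov2017, Agore2016, CarinenaGrabowskiMarmo2000,
BlaserLysikov2016]
#3 StrassenPencil (crux) — n = 2 CENSUS (card C4): some associative pencil through Mat_2 realises
Strassen's 7 — there is an associative ν on ℂ^(2×2) with μ_2 − ν associative, both nodes non-zero
tensors, and R(ν) + R(μ_2 − ν) ≤ 7. Decidable: by Sokolov2017 Prop. 3.1 the compatible products on
Mat_2 are, up to equivalence ν ~ k₁ν + k₂μ, the sandwiches X·c·Y (nodes ⟨2,1,2⟩ + ⟨2,1,2⟩: 4 + 4 =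
8) and (aX − Xa)(bY − Yb) (R(X) = a(Xb − bX), an Ã₃ M-structure; the Nijenhuis eigenvalue pattern
gives ≤ 3 nodes); the planner's hand computation of one Ã₃ pencil (R = 1 − E₁₁·(·)·E₂₂) gives nodes
= radical-square-zero 2-cycle algebra (rank 6, Alder–Strassen 2·4 − 2) + a nilpotent algebra (rank
2) = 8. A YES says Strassen's algorithm is interpolation between two associative algebras; a NO
(every pencil on Mat_2 costs ≥ 8) is the base case of NodeRigidity's moral. [difficulty: M] (why it
might fail: both classified families seem to give 8: a node with a 3-dimensional Mat_2-quotient (≅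
upper-triangular T_2, rank 4) pairs with a node of image dimension ≤ 2 whose rank must then be
exactly 3, and Alder–Strassen-type bounds on the 4-dimensional node algebras may exclude 4+3, 5+2
and 6+1 alike.) [Sokolov2017, Strassen1969, AlderStrassen1981, Winograd1971, DeGroote1978]
#4 LargeSubalgebraMatMul (crux) — SUBALGEBRA HALF of the engine (card failure mode "nodes contain
⟨n,r,n⟩-type blocks", made basis-free): there is an absolute η > 0 such that every (not necessarily
unital) subalgebra A ⊆ Mat_n(ℂ) with 2·dim A ≥ n² has multiplication tensor (in any basis)
restricting to some ⟨a,b,c⟩ with abc ≥ η·n³. Model cases: the upper-triangular algebra contains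
⟨n/2, n/4, n/4⟩ (via M·D′, M the top-right block, D′ triangular), block-diagonal Mat_(n/2) ⊕
Mat_(n/2) contains ⟨n/2,n/2,n/2⟩; a proper unital subalgebra has dim ≤ n² − n + 1 (Agore2016) and a
basic one sits in a Borel of dimension n(n+1)/2, so dim ≥ n²/2 leaves codimension ≤ n/2 there.
[difficulty: M] (why it might fail: a codimension-n/2 subalgebra of the Borel algebra, or a
subalgebra with many small Levi blocks glued by a thin radical, might meet every large rectangular
block product only partially; restriction needs aligned sub-blocks, and the true exponent of abc
could be n^(3−δ) rather than ηn³.) [Agore2016, BurgisserClausenShokrollahi1997, AlderStrassen1981,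
Blaser2013]
#5 NodeQuotients (crux) — NODE-STRUCTURE HALF of the engine (Odesskii–Sokolov theory extended past
the ADE cases): for every n and every associative ν on ℂ^(n×n) with μ_n − ν associative, the two
node algebras (ℂ^(n×n), ν) and (ℂ^(n×n), μ_n − ν) admit multiplicative linear maps S₁, S₂ into
Mat_n(ℂ) (n-dimensional representations) whose image dimensions sum to at least n². Known when the
pencil has a Nijenhuis representative R (S_λ = 1 + λR: nodes are eigenvalues ρ, S = R − ρ, kernels
are eigenspaces, Σ dim ker ≤ n²) — all sandwich and affine-ADE pencils (OdesskiiSokolov2007 §5) and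
both Mat_2 families; with LargeSubalgebraMatMul (image of the larger S_i is a subalgebra of
dimension ≥ n²/2 and a quotient's tensor is a restriction of the node's) it yields NodeRigidity.
[difficulty: L] (why it might fail: rests on every compatible product admitting a Nijenhuis
(first-order) trivialisation; Odesskii–Sokolov only prove S_λ meromorphic in general, and a
genuinely higher-order S_λ could give nodes with small Mat_n-quotients (large kernels at both
nodes).) [OdesskiiSokolov2007, OdesskiiSokolov2006, Sokolov2017, CarinenaGrabowskiMarmo2000,
Agore2016]
#9 LagrangeNodeBound (support) — divided-difference Lagrange bound (Bini's interpolation device, BCS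
Prop. (15.26), for exact rank): for distinct nodes t_0..t_s and any tensor coefficients ν_0..ν_s,
ν_s = Σ_i F(t_i)/Π_(k≠i)(t_i − t_k) with F(t) = Σ_j t^j ν_j, hence R(ν_s) ≤ Σ_i R(F(t_i)) by
subadditivity (tensorRank_add_le, PROVED) and scalar invariance. [difficulty: provable-now]
[BurgisserClausenShokrollahi1997, Blaser2013]
#9 RankBoundToOmega (support) — one format at a time suffices: if for infinitely many n ≥ 2,
R(⟨n,n,n⟩) ≤ C·n^(2+ε), then ω(ℂ) ≤ 2 + ε (Blaser2013 Thm 5.9, in-tree Blaser2013Thm59_holds: ω ≤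
log_n R(⟨n,n,n⟩) ≤ 2 + ε + log C/log n, and n → ∞ along the subsequence). [difficulty: provable-now]
[Blaser2013, BurgisserClausenShokrollahi1997]

TWO-LAYER PLAN. NodeRigidity ⇐ NodeQuotients → LargeSubalgebraMatMul → NodeRigidity (glue: the image
of a multiplicative linear map is a
subalgebra whose multiplication tensor is a restriction of the node's; the larger image has 2·dim ≥
n²) — both children are
filed now as cruxes because each is a self-contained theorem-candidate; the glue statement is filed
only when one closes.
NodeQuotients ⇐ NijenhuisNormalForm (every compatible product on Mat_n has a representative R with
R(x)R(y) = R(x∘y)) →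
EigenspaceCount → NodeQuotients. TameNodeCurves ⇐ (s = 1) TamePencil ∨ (s ≥ 2) TameCurve once
NodeRigidity settles the
pencil case. StrassenPencil ⇐ SandwichCase → CommutatorCase (Sokolov2017 Prop 3.1's two families) if
a prover wants the split.

KILL CRITERIA. NodeRigidity PROVED (e.g. via NodeQuotients + LargeSubalgebraMatMul) reduces the s =
1 case of the thesis to "R(⟨m,m,m⟩) =
O(m²) infinitely often" and shows every associative pencil is a mere self-reduction: demote to the
curve case (s ≥ 2); if in
addition every degenerate fibre of a rational curve of associative products through Mat_n is shown
to carry ⟨a,b,c⟩ with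
abc ≥ ηn³ (the curve analogue, to be filed then), close `superseded`/`exhausted` with the rigidity
theorem as the census.
TameNodeCurves refuted outright (a super-quadratic lower bound for tame covers) closes
`refuted:TameNodeCurves` — beyond
current lower-bound technique (LinearRankMethodBarrier), so not expected. StrassenPencil refuted +
NodeRigidity proved ⇒
close. Any positive route proving ω = 2 moots the assembly but not the structural cruxes.

NOT DECOMPOSED YET. The curve case s ≥ 2 (which degenerations of Mat_n can be nodes of ONE rational
curve, and whether n^ε cheap
degenerations can span ⟨n,n,n⟩) — waits for the pencil case. The n = 3 census (an associative pencil
with R(ν) + R(μ_3 − ν)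
≤ 22 would beat Laderman1976's 23; sandwich gives ≤ 9 + 15 = 24, HopcroftKerr1971) — a computation
item once StrassenPencil's
method exists. The card's degeneration question "is ℂ[x,y]/(x^n,y^n) an algebra-degeneration of
Mat_n (n = 2: of Mat_2 in
Alg_4)?" — bears on which tame algebras can be nodes at all, filed only if the curve case opens.
Border-rank versions of every
item (algBorderRank, Bini = Blaser2013_thm66_holds PROVED) — same shape, filed if provers prefer bR
certificates. Constants η.

CHEAPEST FALSIFIER. StrassenPencil by computation: Sokolov2017 Prop. 3.1 lists ALL compatible
products on Mat_2 (sandwich X·c·Y, c in Jordan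
form; (aX−Xa)(bY−Yb) with a = diag(1,−1), b² = 1 one essential parameter, plus nilpotent limits);
for each, the Nijenhuis
operator R has ≤ 3 eigenvalues = nodes; compute the 4×4×4 node tensors and their exact ranks
(flattening/substitution lower
bounds, explicit decompositions). Planner's hand check of two pencils (sandwich; R = 1 − E₁₁(·)E₂₂)
gives 8 both times and
R(T_2) = 4 for the triangular quotient. If every Mat_2 pencil costs ≥ 8 AND the Nijenhuis eigenspace
count is verified on the
Ã/D̃/Ẽ formulas of OdesskiiSokolov2007 §5, the positive side is down to unclassified non-semisimple
M-structures.

NUMBERS. R(⟨2,2,2⟩) = 7 (Strassen1969; Winograd1971 lower bound; DeGroote1978 uniqueness of optimal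
algorithms); sandwich pencil on Mat_2: 4 + 4 = 8;
Ã₃ pencil on Mat_2: 6 + 2 = 8 (Alder–Strassen R(A) ≥ 2·dim A − t(A) = 8 − 2 for the
radical-square-zero 2-cycle algebra).
R(⟨3,3,3⟩) ≤ 23 (Laderman1976), sandwich pencil 9 + 15 = 24 (R(⟨3,1,3⟩) = 9, R(⟨3,2,3⟩) ≤ 15,
HopcroftKerr1971); bR(⟨3,3,3⟩)
≥ 17 (ConnerHarperLandsberg2019), ≤ 20 (Smirnov). Lower frame R(⟨n,n,n⟩) ≥ 3n² − o(n²)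
(Landsberg2014), bR ≥ 2n² − log₂n − 1
(LandsbergMichalek2018): a tame PENCIL (s = 1, two nodes ≤ C n²) needs C ≥ 3/2. Proper unital
subalgebras of Mat_n have
dim ≤ n² − n + 1 (Agore2016); nilpotent ones ≤ n(n−1)/2; the Borel has n(n+1)/2. Items at open: 8
(target, 4 cruxes, 2
support, assembly).

DEFINITION REQUESTS. None blocking: associativity of a coordinate tensor, compatibility, and the
node tensors are inlined over matMulTensor /
tensorRank / TensorRestrictsTo (all in Literature.Computability.AlgebraicComplexity). A shared
`IsAssocTensor` /
`compatibleWith` predicate in Literature/Algebra would shorten every item and is worth a definition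
item if a second route
(e.g. a border-rank twin) appears. Facts wanted as named Literature Props (organising, never
hypotheses of the assembly):
Sokolov2017 Prop 3.1 (Mat_2 classification); OdesskiiSokolov2007 Thms 3.3–3.4, 4.1–4.2 (M-structures
↔ compatible products;
semisimple case ↔ affine ADE quivers); Alder–Strassen R(A) ≥ 2 dim A − t(A) (AlderStrassen1981).

Novelty: Searches (2026-08-15): `lit search --hybrid "compatible associative products matrix algebra
Nijenhuis operator"` (10 book
hits, none relevant); zbMATH "linear deformations of matrix algebra compatible multiplication" (4:
OdesskiiSokolov2007 + 3
unrelated), "Nijenhuis operators matrix algebra classification" (0), "compatible associative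
products classification
two-dimensional matrix" (1, unrelated), "maximal dimension subalgebra matrix algebra Agore" (2:
Agore2016, Eggers–Evans–van
Veen 2017); crossref "Nijenhuis operators on 2x2 matrix algebra" (10, Hom- /dendriform Nijenhuis
papers, none on Mat_n
deformations + complexity), "Ubiquity of the exponent" (LimYe2020); `lit galaxy search "compatible
associative algebras"
--star all` (5: Sokolov's World Scientific book, OS J.Phys.A math/0604574, Odesskii–Rubtsov–Sokolov
double Poisson,
Bloch–Brînzănescu flows) and `--in-book` Sokolov (Prop 3.1.2 = Sokolov2017 Prop 3.1, read); `lit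
read arXiv:math/0611200`
pp 1–12 (Thms 1.1, 2.2, 3.1–3.5, 4.1–4.3, Appendix Ã/D̃/Ẽ formulas, "in all cases S_λ = 1 + λR");
`lit frontier
MatrixMultiplication --since 2021` (30 rows: asymptotic spectra, border subrank of algebras
arXiv:2604.19872, flip-graph /
catalogue searches arXiv:2606.13408 — nothing on pencils in Alg_N); the card's own audit queries
(zbMATH OS ×3, "compatible
associative algebras matrix multiplication complexity" 0). OpenAlex budget exhausted and arXiv API
rate-limited this
session (logged).
Nearest prior art found: Bini's interpolati  [refs: math/0611200, 2604.19872, 2606.13408, OdesskiiSokolov2007, Agore2016, LimYe2020, Sokolov2017, BurgisserClausenShokrollahi1997, OdesskiiSokolov2006, BlaserLysikov2016]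

Barriers (technique_class: structure-tensor-of-algebra, linear-self-reduction): - technique_class: structure-tensor-of-algebra, linear-self-reduction
- Literature.Barriers.MatrixMultiplication.InfimumNotMinimumBarrier: respected, and it shapes X — no
fixed-n certificate is claimed (a pencil at one n gives only ω ≤ log_n((s+1)Cn²)); the thesis
quantifies over infinitely many n with the rate C·n^(2+ε); StrassenPencil is a census, not an
exponent certificate.
- Literature.Barriers.MatrixMultiplication.UnstableTensorBarrier: the tame nodes are typically
unstable structure tensors of algebras with radical, but they are never Kronecker-powered nor used
as fixed intermediate tensors — one linear identity per n with n → ∞ (the entry's own evasion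
"sequences of increasing size"); its moral survives inside NodeRigidity (cheapness cannot come from
a fixed degenerate algebra).
- Literature.Barriers.MatrixMultiplication.IrreversibilityBarrier: no intermediate tensor and no
asymptotic conversion rate is used; n/a beyond the remark above.
- Literature.Barriers.MatrixMultiplication.UniversalMethodBarrier: not a degeneration-of-powers
method (no T^⊗N, no monomial degeneration); n/a.
- Literature.Barriers.MatrixMultiplication.RectangularBarrier: no CW_q input; the only rectangular
products that appear are the sandwich nodes ⟨n,r,n⟩, as objects to be beaten, not as a method.
- Literature.Barriers.MatrixMultiplication.LinearRankMethodBarrier: bites only on the NEGATIVE side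
if one tried to refute tameness of a specific node family by flattenings (caps at O(n²) = exactly
the

History (route lifecycle, newest last):
- 2026-08-16T04:10:29Z · AUTO-CRUX (backfill): TameNodeCurves — hypotheses of the deciding theorem that nothing in the route derives are cruxes (operator:999:1085951)
- 2026-08-22T04:18:03Z · DORMANT — reconciler: no traction for 5.1 d (last activity item-evidence-added at 2026-08-17T02:19:31Z); parked, not closed — `ledger route dormant route-MatrixMultiplica (operator:999:2759436)

sub-problem: MatrixMultiplication · status: dormant · opened planner-plancard-MatrixMultiplication-MatrixM-ab650f37-0 2026-08-15T12:04:57Z · rev 2 · ledger route-MatrixMultiplication-AssociativePencil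
GENERATED by the gate from the ledger (D-0016/17). Provers cite these decls: `theorem foo : Summit.MatrixMultiplication.MatrixMultiplication.Theses.AssociativePencil.<Decl> := …` in Summits/MatrixMultiplication/MatrixMultiplication/Theorems/<Name>.lean.
-/

namespace Summit.MatrixMultiplication.MatrixMultiplication.Theses.AssociativePencil

open scoped BigOperators Topology Manifold Classical MeasureTheory ProbabilityTheory Matrix InnerProductSpace ComplexConjugate ContinuousMap
open Filter Set Function TopologicalSpace MeasureTheory

attribute [summit_statement] _root_.MatrixMultiplication

/-- item stmt-MatrixMultiplication-7189 · crux (kind.auto-crux: conjecture-grade) · rank 0 · open · by planner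
why it might fail: NodeRigidity: for s = 1 one node always carries ⟨a,b,c⟩ with abc ≥ ηn³, so tame pencils force R(⟨m,m,m⟩) = O(m²); tame higher-degree curves may not exist either (every node is a degeneration of Mat_n and cheap ones may span too little).
sources: OdesskiiSokolov2007, OdesskiiSokolov2006, BurgisserClausenShokrollahi1997, BlaserLysikov2016, LimYe2020
[target] X as in § Thesis: ∀ε>0 ∃C ∀n₀ ∃n≥n₀ ∃s with s+1 ≤ n^ε and a degree-s polynomial family of
associative products on ℂ^(n×n) with top coefficient ⟨n,n,n⟩ and s+1 distinct nodes of tensor rank ≤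
C·n². -/
@[route_item "route-MatrixMultiplication-AssociativePencil", crux]
def TameNodeCurves : Prop :=
  ∀ ε : ℝ, 0 < ε → ∃ C : ℝ, 0 < C ∧ ∀ n₀ : ℕ, ∃ n : ℕ, n₀ ≤ n ∧ 2 ≤ n ∧ ∃ s : ℕ, (s : ℝ) + 1 ≤ (n : ℝ) ^ ε ∧ ∃ ν : Fin (s + 1) → (Fin n × Fin n → Fin n × Fin n → Fin n × Fin n → ℂ), ν (Fin.last s) = Literature.Computability.AlgebraicComplexity.matMulTensor ℂ n n n ∧ (∀ t : ℂ, ∀ x y z w : Fin n × Fin n, ∑ u, (∑ j : Fin (s + 1), t ^ (j : ℕ) * ν j u x y) * (∑ j : Fin (s + 1), t ^ (j : ℕ) * ν j w u z) = ∑ v, (∑ j : Fin (s + 1), t ^ (j : ℕ) * ν j v y z) * (∑ j : Fin (s + 1), t ^ (j : ℕ) * ν j w x v)) ∧ ∃ node : Fin (s + 1) → ℂ, Function.Injective node ∧ ∀ i, (Literature.Computability.AlgebraicComplexity.tensorRank (fun z x y => ∑ j : Fin (s + 1), node i ^ (j : ℕ) * ν j z x y) : ℝ) ≤ C * (n : ℝ)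 ^ 2

/-- item stmt-MatrixMultiplication-7190 · crux · rank 2 · open · by planner
why it might fail: compatible products outside the Nijenhuis normal form (S_λ with higher Taylor terms; M-structures with non-semisimple A, B are unclassified) may have two nodes whose Mat_n-quotients are both small; and RESTRICTION to a full ⟨a,b,c⟩ is demanded, not degeneration.
sources: OdesskiiSokolov2007, Sokolov2017, Agore2016, CarinenaGrabowskiMarmo2000, BlaserLysikov2016
[crux] NEGATIVE ENGINE (parent of NodeQuotients + LargeSubalgebraMatMul; card "fastest refutation"
made precise): there is an absolute η > 0 such that for every n and every associative ν on ℂ^(n×n)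
with μ_n − ν associative (i.e. every pair of nodes of every associative pencil through Mat_n, up to
scaling), one of the two node tensors ν, μ_n − ν restricts to a matrix product ⟨a,b,c⟩ with abc ≥
η·n³. Consequence: pencil nodes are never cheaper than linear-size MaMu, pencils are self-reductions
only, and TameNodeCurves at s = 1 becomes R(⟨m,m,m⟩) = O(m²) infinitely often. Its REFUTATION is
exactly the exotic pencil the positive side wants — informative both ways. [difficulty: L] -/
@[route_item "route-MatrixMultiplication-AssociativePencil"]
def NodeRigidity : Prop :=
  ∃ η : ℝ, 0 < η ∧ ∀ (n : ℕ) (ν : Fin n × Fin n → Fin n × Fin n → Fin n × Fin n → ℂ), (∀ x y z w : Fin n × Fin n, ∑ u, ν u x y * ν w u z = ∑ v, ν v y z * ν w x v) → (∀ x y z w : Fin n × Fin n, ∑ u, (Literature.Computability.AlgebraicComplexity.matMulTensor ℂ n n n u x y - ν u x y) * (Literature.Computability.AlgebraicComplexity.matMulTensor ℂ n n n w u z - ν w u z) = ∑ v, (Literature.Computability.AlgebraicComplexity.matMulTensor ℂ n n n v y z - ν v y z) * (Literature.Computability.AlgebraicComplexity.matMulTensor ℂ n n n w x v - ν w x v))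 → ∃ a b c : ℕ, η * (n : ℝ) ^ 3 ≤ (a * b * c : ℕ) ∧ (Literature.Computability.AlgebraicComplexity.TensorRestrictsTo ν (Literature.Computability.AlgebraicComplexity.matMulTensor ℂ a b c) ∨ Literature.Computability.AlgebraicComplexity.TensorRestrictsTo (fun z x y => Literature.Computability.AlgebraicComplexity.matMulTensor ℂ n n n z x y - ν z x y) (Literature.Computability.AlgebraicComplexity.matMulTensor ℂ a b c))

/-- item stmt-MatrixMultiplication-7191 · crux · rank 3 · open · by planner
why it might fail: both classified families seem to give 8: a node with a 3-dimensional Mat_2-quotient (≅ upper-triangular T_2, rank 4) pairs with a node of image dimension ≤ 2 whose rank must then be exactly 3, and Alder–Strassen-type bounds on the 4-dimensional node algebras may exclude 4+3, 5+2 and 6+1 alike.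
sources: Sokolov2017, Strassen1969, AlderStrassen1981, Winograd1971, DeGroote1978
[crux] n = 2 CENSUS (card C4): some associative pencil through Mat_2 realises Strassen's 7 — there
is an associative ν on ℂ^(2×2) with μ_2 − ν associative, both nodes non-zero tensors, and R(ν) +
R(μ_2 − ν) ≤ 7. Decidable: by Sokolov2017 Prop. 3.1 the compatible products on Mat_2 are, up to
equivalence ν ~ k₁ν + k₂μ, the sandwiches X·c·Y (nodes ⟨2,1,2⟩ + ⟨2,1,2⟩: 4 + 4 = 8) and (aX −
Xa)(bY − Yb) (R(X) = a(Xb − bX), an Ã₃ M-structure; the Nijenhuis eigenvalue pattern gives ≤ 3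
nodes); the planner's hand computation of one Ã₃ pencil (R = 1 − E₁₁·(·)·E₂₂) gives nodes =
radical-square-zero 2-cycle algebra (rank 6, Alder–Strassen 2·4 − 2) + a nilpotent algebra (rank 2)
= 8. A YES says Strassen's algorithm is interpolation between two associative algebras; a NO (every
pencil on Mat_2 costs ≥ 8) is the base case of NodeRigidity's moral. [difficulty: M] -/
@[route_item "route-MatrixMultiplication-AssociativePencil"]
def StrassenPencil : Prop :=
  ∃ ν : Fin 2 × Fin 2 → Fin 2 × Fin 2 → Fin 2 × Fin 2 → ℂ, (∀ x y z w : Fin 2 × Fin 2, ∑ u, ν u x y * ν w u z = ∑ v, ν v y z * ν w x v) ∧ (∀ x y z w : Fin 2 × Fin 2, ∑ u, (Literature.Computability.AlgebraicComplexity.matMulTensor ℂ 2 2 2 u x y - ν u x y) * (Literature.Computability.AlgebraicComplexity.matMulTensor ℂ 2 2 2 w u z - ν w u z) = ∑ v, (Literature.Computability.AlgebraicComplexity.matMulTensor ℂ 2 2 2 v y z - ν v y z) * (Literature.Computability.AlgebraicComplexity.matMulTensor ℂ 2 2 2 w x v - ν w x v)) ∧ 0 < Literature.Computability.AlgebraicComplexity.tensorRank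 ν ∧ 0 < Literature.Computability.AlgebraicComplexity.tensorRank (fun z x y => Literature.Computability.AlgebraicComplexity.matMulTensor ℂ 2 2 2 z x y - ν z x y) ∧ Literature.Computability.AlgebraicComplexity.tensorRank ν + Literature.Computability.AlgebraicComplexity.tensorRank (fun z x y => Literature.Computability.AlgebraicComplexity.matMulTensor ℂ 2 2 2 z x y - ν z x y) ≤ 7

/-- item stmt-MatrixMultiplication-7192 · crux · rank 4 · open · by planner
why it might fail: a codimension-n/2 subalgebra of the Borel algebra, or a subalgebra with many small Levi blocks glued by a thin radical, might meet every large rectangular block product only partially; restriction needs aligned sub-blocks, and the true exponent of abc could be n^(3−δ) rather than ηn³.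
sources: Agore2016, BurgisserClausenShokrollahi1997, AlderStrassen1981, Blaser2013
[crux] SUBALGEBRA HALF of the engine (card failure mode "nodes contain ⟨n,r,n⟩-type blocks", made
basis-free): there is an absolute η > 0 such that every (not necessarily unital) subalgebra A ⊆
Mat_n(ℂ) with 2·dim A ≥ n² has multiplication tensor (in any basis) restricting to some ⟨a,b,c⟩ with
abc ≥ η·n³. Model cases: the upper-triangular algebra contains ⟨n/2, n/4, n/4⟩ (via M·D′, M the
top-right block, D′ triangular), block-diagonal Mat_(n/2) ⊕ Mat_(n/2) contains ⟨n/2,n/2,n/2⟩; a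
proper unital subalgebra has dim ≤ n² − n + 1 (Agore2016) and a basic one sits in a Borel of
dimension n(n+1)/2, so dim ≥ n²/2 leaves codimension ≤ n/2 there. [difficulty: M] -/
@[route_item "route-MatrixMultiplication-AssociativePencil"]
def LargeSubalgebraMatMul : Prop :=
  ∃ η : ℝ, 0 < η ∧ ∀ (n : ℕ) (A : NonUnitalSubalgebra ℂ (Matrix (Fin n) (Fin n) ℂ)) (m : ℕ) (β : Module.Basis (Fin m) ℂ A), n ^ 2 ≤ 2 * m → ∃ a b c : ℕ, η * (n : ℝ) ^ 3 ≤ (a * b * c : ℕ) ∧ Literature.Computability.AlgebraicComplexity.TensorRestrictsTo (fun z x y => β.repr (β x * β y) z) (Literature.Computability.AlgebraicComplexity.matMulTensor ℂ a b c)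

/-- item stmt-MatrixMultiplication-7193 · crux · rank 5 · open · by planner
why it might fail: rests on every compatible product admitting a Nijenhuis (first-order) trivialisation; Odesskii–Sokolov only prove S_λ meromorphic in general, and a genuinely higher-order S_λ could give nodes with small Mat_n-quotients (large kernels at both nodes).
sources: OdesskiiSokolov2007, OdesskiiSokolov2006, Sokolov2017, CarinenaGrabowskiMarmo2000, Agore2016
[crux] NODE-STRUCTURE HALF of the engine (Odesskii–Sokolov theory extended past the ADE cases): for
every n and every associative ν on ℂ^(n×n) with μ_n − ν associative, the two node algebras (ℂ^(n×n),
ν) and (ℂ^(n×n), μ_n − ν) admit multiplicative linear maps S₁, S₂ into Mat_n(ℂ) (n-dimensional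
representations) whose image dimensions sum to at least n². Known when the pencil has a Nijenhuis
representative R (S_λ = 1 + λR: nodes are eigenvalues ρ, S = R − ρ, kernels are eigenspaces, Σ dim
ker ≤ n²) — all sandwich and affine-ADE pencils (OdesskiiSokolov2007 §5) and both Mat_2 families;
with LargeSubalgebraMatMul (image of the larger S_i is a subalgebra of dimension ≥ n²/2 and a
quotient's tensor is a restriction of the node's) it yields NodeRigidity. [difficulty: L] -/
@[route_item "route-MatrixMultiplication-AssociativePencil"]
def NodeQuotients : Prop :=
  ∀ (n : ℕ) (ν : Fin n × Fin n → Fin n × Fin n → Fin n × Fin n → ℂ), (∀ x y z w : Fin n × Fin n, ∑ u, ν u x y * ν w u z = ∑ v, ν v y z * ν w x v) → (∀ x y z w : Fin n × Fin n, ∑ u, (Literature.Computability.AlgebraicComplexity.matMulTensor ℂ n n n u x y - ν u x y) * (Literature.Computability.AlgebraicComplexity.matMulTensor ℂ n n n w u z - ν w u z) = ∑ v, (Literature.Computability.AlgebraicComplexity.matMulTensor ℂ n n n v y z - ν v y z) * (Literature.Computability.AlgebraicComplexity.matMulTensor ℂ n n n w x v - ν w x v)) → ∃ S₁ S₂ :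 Fin n × Fin n → Matrix (Fin n) (Fin n) ℂ, (∀ x y, S₁ x * S₁ y = ∑ z, ν z x y • S₁ z) ∧ (∀ x y, S₂ x * S₂ y = ∑ z, (Literature.Computability.AlgebraicComplexity.matMulTensor ℂ n n n z x y - ν z x y) • S₂ z) ∧ n ^ 2 ≤ Module.finrank ℂ (Submodule.span ℂ (Set.range S₁)) + Module.finrank ℂ (Submodule.span ℂ (Set.range S₂))

/-- item stmt-MatrixMultiplication-7194 · support · rank 9 · closed · proved by Summit.MatrixMultiplication.MatrixMultiplication.Theorems.lagrangeNodeBound_proof @ 5650e60faa7f (prover) · by planner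
sources: BurgisserClausenShokrollahi1997, Blaser2013
[support] divided-difference Lagrange bound (Bini's interpolation device, BCS Prop. (15.26), for
exact rank): for distinct nodes t_0..t_s and any tensor coefficients ν_0..ν_s, ν_s = Σ_i
F(t_i)/Π_(k≠i)(t_i − t_k) with F(t) = Σ_j t^j ν_j, hence R(ν_s) ≤ Σ_i R(F(t_i)) by subadditivity
(tensorRank_add_le, PROVED) and scalar invariance. [difficulty: provable-now] -/
@[route_item "route-MatrixMultiplication-AssociativePencil", crux]
def LagrangeNodeBound : Prop :=
  ∀ (n s : ℕ) (ν : Fin (s + 1) → (Fin n × Fin n → Fin n × Fin n → Fin n × Fin n → ℂ)) (node : Fin (s + 1) → ℂ), Function.Injective node → Literature.Computability.AlgebraicComplexity.tensorRank (ν (Fin.last s)) ≤ ∑ i, Literature.Computability.AlgebraicComplexity.tensorRank (fun z x y => ∑ j : Fin (s + 1), node i ^ (j : ℕ) * ν j z x y)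

/-- item stmt-MatrixMultiplication-7195 · support · rank 9 · closed · proved by Summit.MatrixMultiplication.MatrixMultiplication.Theorems.rankBoundToOmega_proof @ c26f1f606469 (prover) · by planner
sources: Blaser2013, BurgisserClausenShokrollahi1997
[support] one format at a time suffices: if for infinitely many n ≥ 2, R(⟨n,n,n⟩) ≤ C·n^(2+ε), then
ω(ℂ) ≤ 2 + ε (Blaser2013 Thm 5.9, in-tree Blaser2013Thm59_holds: ω ≤ log_n R(⟨n,n,n⟩) ≤ 2 + ε + log
C/log n, and n → ∞ along the subsequence). [difficulty: provable-now] -/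
@[route_item "route-MatrixMultiplication-AssociativePencil", crux]
def RankBoundToOmega : Prop :=
  ∀ ε : ℝ, 0 < ε → ∀ C : ℝ, 0 < C → (∀ n₀ : ℕ, ∃ n : ℕ, n₀ ≤ n ∧ 2 ≤ n ∧ (Literature.Computability.AlgebraicComplexity.tensorRank (Literature.Computability.AlgebraicComplexity.matMulTensor ℂ n n n) : ℝ) ≤ C * (n : ℝ) ^ (2 + ε)) → Literature.Computability.AlgebraicComplexity.omega ℂ ≤ 2 + ε

/-- item stmt-MatrixMultiplication-7196 · assembly · rank 1 · closed · proved by Summit.MatrixMultiplication.MatrixMultiplication.Theorems.associativePencil_assembly_proof @ 0f50717ee7ae (prover) · by planner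
sources: Blaser2013, BurgisserClausenShokrollahi1997
[assembly] LagrangeNodeBound → RankBoundToOmega → TameNodeCurves → MatrixMultiplication (ω(ℂ) = 2). -/
@[route_item "route-MatrixMultiplication-AssociativePencil"]
def Assembly : Prop :=
  LagrangeNodeBound → RankBoundToOmega → TameNodeCurves → MatrixMultiplication

/-! D-0027 §2.1 — DECIDING THEOREM (planner-authored via `route open/edit --closes-file`; by planner-rbadge-MatrixMultiplication-Associativ-5bac35d4-g2-0 2026-08-15T16:21:12Z):
its hypotheses are this route's items and its conclusion the sub-problem Statement (glue_lint), and it elaborates with this file. -/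

@[closes "route-MatrixMultiplication-AssociativePencil"] theorem closes (hL : LagrangeNodeBound) (hR : RankBoundToOmega) (hT : TameNodeCurves) :
    _root_.MatrixMultiplication := by
  rw [MatrixMultiplication_iff]
  refine le_antisymm ?_ (Literature.Computability.AlgebraicComplexity.omega_two_le ℂ)
  refine le_of_forall_pos_le_add fun ε hε => ?_
  obtain ⟨C, hC, hall⟩ := hT ε hε
  refine hR ε hε C hC fun n₀ => ?_
  obtain ⟨n, hn₀, h2, s, hs, ν, hνs, -, node, hnode, htame⟩ := hall n₀
  refine ⟨n, hn₀, h2, ?_⟩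
  -- Lagrange interpolation at the `s + 1` nodes: `R(ν_s) ≤ ∑ i, R(F(node i))`, and `ν_s = ⟨n,n,n⟩`.
  have hLag := hL n s ν node hnode
  rw [hνs] at hLag
  have hLagR : (Literature.Computability.AlgebraicComplexity.tensorRank
      (Literature.Computability.AlgebraicComplexity.matMulTensor ℂ n n n) : ℝ) ≤
      ∑ i : Fin (s + 1), (Literature.Computability.AlgebraicComplexity.tensorRank
        (fun z x y => ∑ j : Fin (s + 1), node i ^ (j : ℕ) * ν j z x y) : ℝ) := by
    exact_mod_cast hLag
  have hn0 : (0 : ℝ) < n := by exact_mod_cast (lt_of_lt_of_le (by norm_num) h2 : 0 < n)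
  have hCn : (0 : ℝ) ≤ C * (n : ℝ) ^ 2 := by positivity
  -- tame nodes: each `R(F(node i)) ≤ C n²`, and `s + 1 ≤ n^ε`.
  calc (Literature.Computability.AlgebraicComplexity.tensorRank
        (Literature.Computability.AlgebraicComplexity.matMulTensor ℂ n n n) : ℝ)
      ≤ ∑ i : Fin (s + 1), (Literature.Computability.AlgebraicComplexity.tensorRank
          (fun z x y => ∑ j : Fin (s + 1), node i ^ (j : ℕ) * ν j z x y) : ℝ) := hLagR
    _ ≤ ∑ _i : Fin (s + 1), C * (n : ℝ) ^ 2 := Finset.sum_le_sum fun i _ => htame i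
    _ = ((s : ℝ) + 1) * (C * (n : ℝ) ^ 2) := by
        rw [Finset.sum_const, Finset.card_univ, Fintype.card_fin, nsmul_eq_mul]
        push_cast
        ring
    _ ≤ (n : ℝ) ^ ε * (C * (n : ℝ) ^ 2) := mul_le_mul_of_nonneg_right hs hCn
    _ = C * (n : ℝ) ^ (2 + ε) := by
        rw [Real.rpow_add hn0, Real.rpow_two]
        ring

end Summit.MatrixMultiplication.MatrixMultiplication.Theses.AssociativePencil
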